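import Mathlib
import Summits.AnomalousDissipation.AnomalousDissipation.Theorems.SoloBlindCoupledShermanMorrison

/-!
# SoloBlind — the Sherman–Morrison inverse of a rank-one update (O-SM: the fold-row correction of the γ-Taylor engine)

In the γ-Taylor point engine of LEMMA P (PLAN §127.1 (ii)) the streak/roll matrix at relative γ-offset `η` is
`T(η) = T₀ + Δη·F₁ + ψ(η) e_f e_fᵀ` EXACTLY: an affine-diagonal part, inverted by the certified Neumann series
`S_lin(η)` (kernel `SoloBlindPowerNeumann`), plus a RANK-ONE correction in the fold row `f` coming from the tail value.
The engine then encloses the true inverse by the Sherman–Morrison formula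
`S = S_lin - ψ/(1 + ψ (S_lin)_{ff}) · (S_lin e_f)(e_fᵀ S_lin)`, after certifying `1 + ψ (S_lin)_{ff} ≠ 0` by a
Taylor-model inversion.  This file is the exact algebra behind that step (the owed item O-SM):

* `sandwich` — `(a bᵀ) X (a bᵀ) = (bᵀ X a) · a bᵀ` (with Mathlib's `vecMulVec_mul`, `mul_vecMulVec`);
* `mul_shermanMorrison` — `(M + ψ a bᵀ)(S - α S a bᵀ S) = 1` whenever `M S = 1` and `α (1 + ψ bᵀ S a) = ψ`
  (division-free form);
* `inv_add_smul_vecMulVec` — for invertible `M` and `1 + ψ bᵀ M⁻¹ a ≠ 0`: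
  `(M + ψ a bᵀ)⁻¹ = M⁻¹ - ψ/(1 + ψ bᵀM⁻¹a) · M⁻¹ a bᵀ M⁻¹`, and `isUnit_add_smul_vecMulVec`;
* `inv_add_foldRow` — the fold-row instance `a = b = e_f`, entrywise, literally the engine's formula:
  `(M + ψ e_f e_fᵀ)⁻¹ i j = M⁻¹ i j - ψ/(1 + ψ M⁻¹ f f) · M⁻¹ i f · M⁻¹ f j`.
-/

namespace Summit.AnomalousDissipation.SoloBlind.RankOneInverse

open Matrix

variable {n : Type*} [Fintype n] [DecidableEq n]

omit [DecidableEq n] in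
/-- The rank-one sandwich: `(a bᵀ) X (a bᵀ) = (bᵀ X a) · a bᵀ`. -/
theorem sandwich (X : Matrix n n ℂ) (a b : n → ℂ) :
    vecMulVec a b * X * vecMulVec a b = ((b ᵥ* X) ⬝ᵥ a) • vecMulVec a b := by
  rw [Matrix.vecMulVec_mul]
  ext i j
  simp only [mul_apply, vecMulVec_apply, Matrix.smul_apply, smul_eq_mul, dotProduct, Finset.sum_mul]
  exact Finset.sum_congr rfl fun x _ => by ring

/-- Sherman–Morrison, division-free: if `M S = 1` and `α (1 + ψ · bᵀ S a) = ψ` then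
`(M + ψ a bᵀ) (S - α · S a bᵀ S) = 1`. -/
theorem mul_shermanMorrison (M S : Matrix n n ℂ) (hMS : M * S = 1) (ψ α : ℂ) (a b : n → ℂ)
    (hα : α * (1 + ψ * ((b ᵥ* S) ⬝ᵥ a)) = ψ) :
    (M + ψ • vecMulVec a b) * (S - α • (S * vecMulVec a b * S)) = 1 := by
  set E := vecMulVec a b with hE
  set d := (b ᵥ* S) ⬝ᵥ a with hd
  have h1 : M * (S * E * S) = E * S := by
    simp only [← Matrix.mul_assoc, hMS, Matrix.one_mul]
  have h2 : E * (S * E * S) = d • (E * S) := by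
    rw [show E * (S * E * S) = (E * S * E) * S by simp only [Matrix.mul_assoc], hE, sandwich, Matrix.smul_mul]
  rw [Matrix.add_mul, Matrix.mul_sub, Matrix.mul_sub, Matrix.smul_mul, Matrix.smul_mul, Matrix.mul_smul,
    Matrix.mul_smul, hMS, h1, h2]
  refine Matrix.ext fun i j => ?_
  simp only [Matrix.add_apply, Matrix.sub_apply, Matrix.smul_apply, smul_eq_mul]
  linear_combination (-((E * S) i j)) * hα

/-- Sherman–Morrison inverse of a rank-one update of an invertible matrix. -/
theorem inv_add_smul_vecMulVec (M : Matrix n n ℂ) (hM : IsUnit M) (ψ : ℂ) (a b : n → ℂ)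
    (hD : 1 + ψ * ((b ᵥ* M⁻¹) ⬝ᵥ a) ≠ 0) :
    (M + ψ • vecMulVec a b)⁻¹
      = M⁻¹ - (ψ / (1 + ψ * ((b ᵥ* M⁻¹) ⬝ᵥ a))) • (M⁻¹ * vecMulVec a b * M⁻¹) := by
  have hdet : IsUnit M.det := (isUnit_iff_isUnit_det M).mp hM
  apply inv_eq_right_inv
  exact mul_shermanMorrison M M⁻¹ (mul_nonsing_inv M hdet) ψ (ψ / (1 + ψ * ((b ᵥ* M⁻¹) ⬝ᵥ a))) a b
    (div_mul_cancel₀ ψ hD)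

/-- … in particular the update is invertible. -/
theorem isUnit_add_smul_vecMulVec (M : Matrix n n ℂ) (hM : IsUnit M) (ψ : ℂ) (a b : n → ℂ)
    (hD : 1 + ψ * ((b ᵥ* M⁻¹) ⬝ᵥ a) ≠ 0) : IsUnit (M + ψ • vecMulVec a b) := by
  have hdet : IsUnit M.det := (isUnit_iff_isUnit_det M).mp hM
  have h : (M + ψ • vecMulVec a b) * (M⁻¹ - (ψ / (1 + ψ * ((b ᵥ* M⁻¹) ⬝ᵥ a))) • (M⁻¹ * vecMulVec a b * M⁻¹)) = 1 :=
    mul_shermanMorrison M M⁻¹ (mul_nonsing_inv M hdet) ψ _ a b (div_mul_cancel₀ ψ hD)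
  exact (isUnit_iff_isUnit_det _).mpr (isUnit_det_of_right_inverse h)

/-- The dot product `e_fᵀ S e_f` is the diagonal entry `S f f`. -/
theorem single_vecMul_dotProduct_single (S : Matrix n n ℂ) (f : n) :
    ((Pi.single f 1 : n → ℂ) ᵥ* S) ⬝ᵥ (Pi.single f 1 : n → ℂ) = S f f := by
  rw [← dotProduct_mulVec, single_one_dotProduct, mulVec_single_one]
  rfl

/-- Entries of `S e_f e_fᵀ S`: `(S e_f e_fᵀ S) i j = S i f · S f j`. -/
theorem sandwichSingle_apply (S : Matrix n n ℂ) (f i j : n) :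
    (S * vecMulVec (Pi.single f 1 : n → ℂ) (Pi.single f 1 : n → ℂ) * S) i j = S i f * S f j := by
  rw [Matrix.mul_vecMulVec, Matrix.vecMulVec_mul, vecMulVec_apply, mulVec_single_one, single_one_vecMul]
  rfl

/-- O-SM, the engine's fold-row formula: for invertible `M` and `1 + ψ M⁻¹ f f ≠ 0`,
`(M + ψ e_f e_fᵀ)⁻¹ i j = M⁻¹ i j - ψ/(1 + ψ M⁻¹ f f) · M⁻¹ i f · M⁻¹ f j`. -/
theorem inv_add_foldRow (M : Matrix n n ℂ) (hM : IsUnit M) (ψ : ℂ) (f : n)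
    (hD : 1 + ψ * M⁻¹ f f ≠ 0) (i j : n) :
    (M + ψ • vecMulVec (Pi.single f 1 : n → ℂ) (Pi.single f 1 : n → ℂ))⁻¹ i j
      = M⁻¹ i j - ψ / (1 + ψ * M⁻¹ f f) * (M⁻¹ i f * M⁻¹ f j) := by
  have hD' : 1 + ψ * (((Pi.single f 1 : n → ℂ) ᵥ* M⁻¹) ⬝ᵥ (Pi.single f 1 : n → ℂ)) ≠ 0 := by
    rwa [single_vecMul_dotProduct_single]
  rw [inv_add_smul_vecMulVec M hM ψ _ _ hD', single_vecMul_dotProduct_single, Matrix.sub_apply, Matrix.smul_apply,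
    smul_eq_mul, sandwichSingle_apply]

/-- … and the fold-row update is invertible. -/
theorem isUnit_add_foldRow (M : Matrix n n ℂ) (hM : IsUnit M) (ψ : ℂ) (f : n)
    (hD : 1 + ψ * M⁻¹ f f ≠ 0) :
    IsUnit (M + ψ • vecMulVec (Pi.single f 1 : n → ℂ) (Pi.single f 1 : n → ℂ)) := by
  apply isUnit_add_smul_vecMulVec M hM
  rwa [single_vecMul_dotProduct_single]

end Summit.AnomalousDissipation.SoloBlind.RankOneInverse
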